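/- WIDTH seat `ym-line-cbag-p1-w2` (prover-ym-line-cbag-p1-w2-g23-0), LINE 7b `GlueballBandRecursion` (volume comparison → rung), in
support of ⟨stmt-QuantumFields-22957⟩: piece C2 proper, part 3 — rotation-invariance of closedness, UNIQUENESS of the rooting rotation of a
connected label family at any scale `m < nᵢ`, and the contrapositive size bound.  Definition-free; route-independent; a helper. -/
import Summits.QuantumFields.YangMills.Theorems.GlueballBandRecursionClosedRooting

/-!
# Route `GlueballBandRecursion`, LINE 7b: closed connected families — rotation-invariance of closedness, uniqueness of the rooting

Complements `Theorems/GlueballBandRecursionClosedRooting.lean` (existence of a rooting rotation at scale `m` for closed connected families with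
`#X ≤ 4m`, `m < nᵢ`).  For the translate-class count «kept supports = `nᵢ` rotations × rooted supports» at the scale `m = a − 1` used by the jet
stub of line 7b (order `3a`), the tree's uniqueness lemma `PeriodicBoxRooting.eq_of_rotFamily_eq_of_boxRooted` does not apply (it needs
`2m ≤ nᵢ`); for CONNECTED families connectivity replaces that hypothesis:

* `closed_image_rot_iff` — the no-free-bond (closedness) condition is invariant under the rotations `BoxLabel.rot i s`
  (`bonds_rot`, `injOn_boxEdgeRot`);
* `succ_mod_ne_of_rooted` — if the rotation by `nᵢ − s` roots `X` at a scale `m < nᵢ`, no member of `X` sits at the level just below `s`;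
* **`rooting_rotation_unique`** — for a connected `X` (sides `≥ 3`) and `m < nᵢ`, two rotations `s, s' < nᵢ` that both root `X` at scale `m`
  (all rotated `i`-coordinates `< m`, some `= 0`) coincide: by `exists_cross_of_reflTransGen` the shifted levels of a connected family form an
  initial segment, so the level below a second root would be occupied;
* `four_mul_add_one_le_card_of_not_rooted` — contrapositive of `exists_rooting_of_closed`: a closed connected family (sides `≥ 4`) that NO
  rotation roots at scale `m < nᵢ` has at least `4m + 1` members (with `m = a − 1`: `≥ 4a − 3 ≥ 3a` for `a ≥ 3`).

HONEST FRAMING.  Finite combinatorics; item 22957, the volume comparison, LINE 7's RECORD rung `ColdDoublingRecursionStrongCoupling` and the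
Yang–Mills mass gap / summit `YangMills` are NOT proved or advanced here.
-/

set_option autoImplicit false

namespace Summit.QuantumFields.YangMills.Theorems.GlueballBandRecursion.SlabCount

open Literature.MathematicalPhysics.QuantumFieldTheory
open Literature.MathematicalPhysics.QuantumFieldTheory.BoxSite (toEdge shift)
open Literature.Probability.LatticeModels (IsRConnected)

variable {d : ℕ} {n : Fin d → ℕ}

/-! ## §1 Closedness is rotation-invariant -/

/-- **The no-free-bond condition is invariant under rotations**: `A.image (rot i s)` is closed iff `A` is. -/
theorem closed_image_rot_iff [DecidableEq (BoxLabel n)] (i : Fin d) (s : ℕ) (A : Finset (BoxLabel n)) :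
    (∀ p ∈ A.image (BoxLabel.rot i s), ∀ e ∈ p.bonds, ∃ q ∈ A.image (BoxLabel.rot i s), q ≠ p ∧ e ∈ q.bonds) ↔
      (∀ p ∈ A, ∀ e ∈ p.bonds, ∃ q ∈ A, q ≠ p ∧ e ∈ q.bonds) := by
  have hinj := injOn_boxEdgeRot i s A
  have hmemU : ∀ {p : BoxLabel n} {e : ZdEdge d}, p ∈ A → e ∈ p.bonds → e ∈ (↑(A.biUnion BoxLabel.bonds) : Set (ZdEdge d)) :=
    fun hp he => by rw [Finset.mem_coe, Finset.mem_biUnion]; exact ⟨_, hp, he⟩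
  constructor
  · intro h p hp e he
    obtain ⟨q', hq', hne, hmem⟩ := h (BoxLabel.rot i s p) (Finset.mem_image_of_mem _ hp) (boxEdgeRot n i s e)
      (by rw [BoxLabel.bonds_rot]; exact Finset.mem_image_of_mem _ he)
    obtain ⟨q, hq, rfl⟩ := Finset.mem_image.1 hq'
    refine ⟨q, hq, fun hqp => hne (by rw [hqp]), ?_⟩
    rw [BoxLabel.bonds_rot, Finset.mem_image] at hmem
    obtain ⟨e', he', hee'⟩ := hmem
    rwa [← hinj (hmemU hq he') (hmemU hp he) hee']
  · intro h p' hp' e' he'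
    obtain ⟨p, hp, rfl⟩ := Finset.mem_image.1 hp'
    rw [BoxLabel.bonds_rot, Finset.mem_image] at he'
    obtain ⟨e, he, rfl⟩ := he'
    obtain ⟨q, hq, hne, hmem⟩ := h p hp e he
    refine ⟨BoxLabel.rot i s q, Finset.mem_image_of_mem _ hq, fun hqp => hne (BoxLabel.rot_injective i s hqp), ?_⟩
    rw [BoxLabel.bonds_rot]
    exact Finset.mem_image_of_mem _ hmem

/-! ## §2 Uniqueness of the rooting rotation for connected families -/

/-- The rotated coordinate is the shifted coordinate: `coord i (rot i (nᵢ − s) p) = (coord i p + nᵢ − s) mod nᵢ` for `s ≤ nᵢ`. -/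
theorem coord_rot_sub_eq (i : Fin d) {s : ℕ} (hs : s ≤ n i) (p : BoxLabel n) :
    BoxLabel.coord i (BoxLabel.rot i (n i - s) p) = (BoxLabel.coord i p + n i - s) % n i := by
  rw [BoxLabel.coord_rot_self]
  congr 1
  omega

/-- **Below a root nothing sits.**  If the rotation by `nᵢ − s` brings every `i`-coordinate of `X` below `m < nᵢ`, then no member of `X` has
its `i`-level just below `s` (cyclically): `(coord i p + 1) mod nᵢ ≠ s` on `X`. -/
theorem succ_mod_ne_of_rooted (i : Fin d) {X : Finset (BoxLabel n)} {m s : ℕ} (hm : m < n i) (hs : s < n i)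
    (hlt : ∀ p ∈ X, BoxLabel.coord i (BoxLabel.rot i (n i - s) p) < m) :
    ∀ p ∈ X, (BoxLabel.coord i p + 1) % n i ≠ s := by
  intro p hp h
  have hc := BoxLabel.coord_lt i p
  have h1 := hlt p hp
  rw [coord_rot_sub_eq i hs.le, add_sub_mod_eq_ite hs hc] at h1
  rw [succ_mod_eq_ite hc] at h
  split_ifs at h h1 <;> omega

variable {G : Type*} [Group G] {N : ℕ} {ρ : G →* Matrix (Fin N) (Fin N) ℂ}

/-- **Uniqueness of the rooting rotation for CONNECTED families, at any scale `m < nᵢ`.**  Let all sides be `≥ 3`, `X` connected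
(`IsRConnected (boxSystem ρ n).Adj X`), `m < nᵢ`, and let `s, s' < nᵢ` both root `X` at scale `m` in direction `i` (every member of
`rot i (nᵢ − s) '' X` has `i`-coordinate `< m` and some member has `i`-coordinate `0`; likewise for `s'`).  Then `s = s'`.
(No hypothesis `2m ≤ nᵢ`: the shifted levels of a connected family form an initial segment — `exists_cross_of_reflTransGen` — so the level
just below a second root would be occupied, contradicting `succ_mod_ne_of_rooted`.) -/
theorem rooting_rotation_unique (hn : ∀ j, 3 ≤ n j) {X : Finset (BoxLabel n)} (hconn : IsRConnected (boxSystem (G := G) ρ n).Adj X)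
    (i : Fin d) {m : ℕ} (hm : m < n i) {s s' : ℕ} (hs : s < n i) (hs' : s' < n i)
    (hlt : ∀ p ∈ X, BoxLabel.coord i (BoxLabel.rot i (n i - s) p) < m)
    (hzero : ∃ p ∈ X, BoxLabel.coord i (BoxLabel.rot i (n i - s) p) = 0)
    (hlt' : ∀ p ∈ X, BoxLabel.coord i (BoxLabel.rot i (n i - s') p) < m)
    (hzero' : ∃ p ∈ X, BoxLabel.coord i (BoxLabel.rot i (n i - s') p) = 0) : s = s' := by
  -- the two roots: members at levels `s` and `s'`
  obtain ⟨p₀, hp₀, h0⟩ := hzero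
  obtain ⟨p₀', hp₀', h0'⟩ := hzero'
  have hc₀ := BoxLabel.coord_lt i p₀
  have hc₀' := BoxLabel.coord_lt i p₀'
  rw [coord_rot_sub_eq i hs.le] at h0
  rw [coord_rot_sub_eq i hs'.le] at h0'
  have hcs : BoxLabel.coord i p₀ = s := by
    rw [(shiftCoord_eq_iff hs hc₀ (by omega)).1 h0, Nat.zero_add, Nat.mod_eq_of_lt hs]
  have hcs' : BoxLabel.coord i p₀' = s' := by
    rw [(shiftCoord_eq_iff hs' hc₀' (by omega)).1 h0', Nat.zero_add, Nat.mod_eq_of_lt hs']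
  -- nothing sits just below either root
  have hbelow := succ_mod_ne_of_rooted i hm hs hlt
  have hbelow' := succ_mod_ne_of_rooted i hm hs' hlt'
  -- the shifted level of the second root, seen from the first
  by_contra hne
  have hj : 0 < (BoxLabel.coord i p₀' + n i - s) % n i := by
    rw [Nat.pos_iff_ne_zero]
    intro h
    have := (shiftCoord_eq_iff hs hc₀' (by omega)).1 h
    rw [Nat.zero_add, Nat.mod_eq_of_lt hs] at this
    exact hne (by rw [← hcs', this])
  -- by connectivity the shifted level just below it carries a member `u`, i.e. `coord u + 1 ≡ s'`
  obtain ⟨u, huX, -, hu⟩ := exists_cross_of_reflTransGen (G := G) (ρ := ρ) hn i hs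
    (fun p hp _ => hbelow p hp) (hconn.2 p₀ hp₀ p₀' hp₀') ((BoxLabel.coord i p₀' + n i - s) % n i - 1)
    (by rw [h0]; exact Nat.zero_le _) (by omega)
  have hcu := BoxLabel.coord_lt i u
  apply hbelow' u huX
  -- arithmetic: `δ_s u = δ_s p₀' − 1` and `coord p₀' = s'` give `(coord u + 1) mod nᵢ = s'`
  rw [add_sub_mod_eq_ite hs hcu, add_sub_mod_eq_ite hs hc₀', hcs'] at hu
  rw [succ_mod_eq_ite hcu]
  split_ifs at hu ⊢ <;> omega

/-! ## §3 The contrapositive size bound -/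

/-- **A closed connected family that no rotation roots at scale `m < nᵢ` has at least `4m + 1` members** (all sides `≥ 4`; contrapositive
of `exists_rooting_of_closed`).  With `m = a − 1` on a box of side `nᵢ = a`: no-free-bond connected supports which do not fit into `a − 1`
consecutive levels of direction `i` have `≥ 4a − 3 ≥ 3a` plaquettes (`a ≥ 3`). -/
theorem four_mul_add_one_le_card_of_not_rooted (hn : ∀ j, 4 ≤ n j) {X : Finset (BoxLabel n)}
    (hclosed : ∀ p ∈ X, ∀ e ∈ p.bonds, ∃ q ∈ X, q ≠ p ∧ e ∈ q.bonds) (hconn : IsRConnected (boxSystem (G := G) ρ n).Adj X)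
    (i : Fin d) {m : ℕ} (hm : m < n i)
    (hno : ¬ ∃ s, s < n i ∧ (∀ p ∈ X, BoxLabel.coord i (BoxLabel.rot i (n i - s) p) < m) ∧
      ∃ p ∈ X, BoxLabel.coord i (BoxLabel.rot i (n i - s) p) = 0) :
    4 * m + 1 ≤ X.card := by
  by_contra h
  exact hno (exists_rooting_of_closed (G := G) (ρ := ρ) hn hclosed hconn i hm (by omega))

end Summit.QuantumFields.YangMills.Theorems.GlueballBandRecursion.SlabCount
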